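import Summits.Langlands.Langlands.Statement
import Summits.Langlands.Langlands.Theorems.SoloBlindUniqueness
import Literature.NumberTheory.GaloisRepresentations.ArtinRestriction
import Literature.NumberTheory.GaloisRepresentations.ArtinRepCoefficientTransport
import Literature.NumberTheory.GaloisRepresentations.ArtinReciprocityCharacterProofs
import Literature.NumberTheory.Automorphic.StrongArtinGL2
import Literature.NumberTheory.PAdicHodge.FontaineDpst
import HarnessLib

/-!
# `Langlands` contains strong Artin reciprocity for every `GL_n` — as an instance, in the tree

A necessary waypoint of ANY proof of summit `Langlands`, made formal.  An `ℓ`-adic representation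
`ρ : Γ_K → GL_n(ℚ̄_ℓ)` with FINITE IMAGE (an Artin representation read through `ι : ℚ̄_ℓ ≅ ℂ`,
Deligne–Serre) is geometric for every pinned reciprocity datum — unconditionally, in the tree:
unramified almost everywhere (open kernel, `FramedGaloisRep.eventually_isUnramifiedAt_of_isOpen_ker`)
and de Rham at `v ∣ ℓ` for Fontaine's pinned datum (`fontainePstAdicCompletion_isDeRhamFramed_of_finite_range`,
Hilbert 90).  Hence conjunct (B) `GaloisToAutomorphic n 𝓡 hcpt` of the summit, specialised to finite
image, IS the strong Artin conjecture for `GL_n` over `K` in the summit's (Buzzard–Gee, L-algebraic,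
arithmetic-Frobenius) normalisation: every irreducible `ρ` with finite image is `r_{ℓ,ι}(π)` for an
L-algebraic cuspidal `π` of `GL_n(𝔸_K)` with full local–global compatibility
(`SoloBlind.exists_cuspidal_of_finite_range`); and for a complex Artin representation
`σ : Γ_K → GL_n(ℂ)` the `ℓ`-adic avatar `GL_n(ι⁻¹) ∘ σ` exists, is geometric, and — if irreducible —
is cuspidal automorphic with `σ(Frob_v)` having characteristic polynomial `∏_{a ∈ α_v} (X - a⁻¹)`,
`α_v` the Satake parameter of `π_v`, at almost every `v` (`SoloBlind.exists_cuspidal_of_artinRep`;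
Tunnell's `IsPiOfArtinRep` is this statement for the contragredient `σ^∨`).  In particular the even
icosahedral representations of `Γ_ℚ` — for which no modularity / potential-automorphy technique is
known to apply (Calegari 2021, §2.6) — are instances the summit must decide.

## References

* P. Deligne, J.-P. Serre, *Formes modulaires de poids 1*, Ann. Sci. ÉNS 7 (1974), §8.6–8.7.
* K. Buzzard, T. Gee, *The conjectural connections between automorphic representations and Galois
  representations*, LMS Lecture Notes 414 (2014), Conj. 3.2.1, Rem. 3.2.5. [BuzzardGeeLMS2014]
* J.-M. Fontaine, B. Mazur, *Geometric Galois representations* (1995), §1 (finite image ⇒ geometric).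
  [FontaineMazurGeometric1995]
* F. Calegari, *Reciprocity in the Langlands program since Fermat's Last Theorem*, arXiv:2109.14145, §2.6.
-/

open scoped MatrixGroups Matrix Classical NumberField Polynomial
open NumberField IsDedekindDomain Filter Field
open Literature.NumberTheory.Automorphic Literature.NumberTheory.GaloisRepresentations
open Literature.NumberTheory.PAdicHodge

noncomputable section

namespace Summit.Langlands.Langlands.Theorems

namespace SoloBlind

variable {K : Type} [Field K] [NumberField K] {ℓ : ℕ} [Fact ℓ.Prime] {n : ℕ}

/-- The image of the local representation `ρ|_{Γ_{K_v}}` lies in the image of `ρ`. [folklore] -/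
theorem range_toLocal_subset (ρ : FramedGaloisRep K (PadicAlgCl ℓ) n) (v : HeightOneSpectrum (𝓞 K)) :
    Set.range (ρ.toLocal v) ⊆ Set.range ρ := by
  rintro _ ⟨σ, rfl⟩
  exact ⟨_, (FramedGaloisRep.toLocal_apply v ρ σ).symm⟩

/-- **Finite-image `ℓ`-adic representations are geometric for every pinned datum** (unconditional):
unramified almost everywhere because the kernel is open, de Rham at `v ∣ ℓ` for Fontaine's pinned datum
because the image is finite (Hilbert 90 over a finite extension).
[cite: FontaineMazurGeometric1995, §1] -/
theorem isGeometricFramed_of_finite_range (𝓡 : ReciprocityData K)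
    (ρ : FramedGaloisRep K (PadicAlgCl ℓ) n) (hρ : (Set.range ρ).Finite) : IsGeometricFramed 𝓡 ρ :=
  ⟨ρ.eventually_isUnramifiedAt_of_isOpen_ker (FramedRep.isOpen_ker_of_finite_range ρ hρ),
    fun v hv ↦ fontainePstAdicCompletion_isDeRhamFramed_of_finite_range v ℓ hv (ρ.toLocal v)
      (hρ.subset (range_toLocal_subset ρ v))⟩

/-- **Conjunct (B) of the summit contains strong Artin reciprocity for `GL_n`** (summit
normalisation): granted `GaloisToAutomorphic n 𝓡 hcpt`, every irreducible `ρ : Γ_K → GL_n(ℚ̄_ℓ)`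
with finite image is `r_{ℓ,ι}(π)` for an L-algebraic cuspidal `π` of `GL_n(𝔸_K)`, with local–global
compatibility at every finite place. [cite: BuzzardGeeLMS2014, Conj. 3.2.1] -/
theorem exists_cuspidal_of_finite_range {𝓡 : ReciprocityData K}
    {hcpt : isCompact_glFiniteIntegralLevel n K} (h : GaloisToAutomorphic n 𝓡 hcpt)
    (ι : PadicAlgCl ℓ ≃+* ℂ) (ρ : FramedGaloisRep K (PadicAlgCl ℓ) n) (hρ : (Set.range ρ).Finite)
    (hirr : ρ.toGaloisRep.IsIrreducible) :
    ∃ π : CuspidalAutomorphicRepData n K hcpt, π.1.IsLAlgebraic ∧ Corresponds 𝓡 ι π.1 ρ :=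
  h ℓ ι ρ hirr (isGeometricFramed_of_finite_range 𝓡 ρ hρ)

/-- A complex Artin representation has finite image, as a `Set.range` statement
(`finite_range_toMonoidHom`). [cite: SerreAbelianLadic1968, Ch. I §1.1 Remark] -/
theorem finite_range_artinRep (σ : FramedArtinRep K n) : (Set.range σ).Finite := by
  haveI := finite_range_toMonoidHom σ
  have h : (Set.range σ.toMonoidHom).Finite := (Set.finite_coe_iff).mp (by
    rw [← MonoidHom.coe_range]; infer_instance)
  exact h

/-- **The `ℓ`-adic avatar of a complex Artin representation and what the summit says about it.**
For `σ : Γ_K → GL_n(ℂ)` continuous and `ι : ℚ̄_ℓ ≅ ℂ` there is `ρ = GL_n(ι⁻¹) ∘ σ : Γ_K → GL_n(ℚ̄_ℓ)`,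
continuous (open kernel; Deligne–Serre §8.7), with `σ = GL_n(ι) ∘ ρ`; it is geometric for every
pinned datum; and, granted conjunct (B) of the summit in degree `n`, if `ρ` is irreducible there is an
L-algebraic cuspidal `π` of `GL_n(𝔸_K)` with `ρ = r_{ℓ,ι}(π)` — so that at almost every finite `v` the
arithmetic Frobenii of `σ` have characteristic polynomial `∏_{a ∈ α_v} (X - a⁻¹)` pushed along `ι`,
`α_v` the Satake parameter of `π_v`. [cite: BuzzardGeeLMS2014, Conj. 3.2.1 and Rem. 3.2.5] -/
theorem exists_cuspidal_of_artinRep (𝓡 : ReciprocityData K)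
    {hcpt : isCompact_glFiniteIntegralLevel n K} (ι : PadicAlgCl ℓ ≃+* ℂ) (σ : FramedArtinRep K n) :
    ∃ ρ : FramedGaloisRep K (PadicAlgCl ℓ) n,
      (∀ g, ρ g = Matrix.GeneralLinearGroup.map (ι.symm : ℂ →+* PadicAlgCl ℓ) (σ g)) ∧
      (∀ g, σ g = Matrix.GeneralLinearGroup.map (ι : PadicAlgCl ℓ →+* ℂ) (ρ g)) ∧
      IsGeometricFramed 𝓡 ρ ∧
      (GaloisToAutomorphic n 𝓡 hcpt → ρ.toGaloisRep.IsIrreducible →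
        ∃ π : CuspidalAutomorphicRepData n K hcpt, π.1.IsLAlgebraic ∧ Corresponds 𝓡 ι π.1 ρ ∧
          ∀ᶠ v : HeightOneSpectrum (𝓞 K) in cofinite, ∃ α : Multiset ℂ,
            π.1.HasSatakeParamAt v α ∧ σ.IsUnramifiedAt v ∧
            σ.HasFrobCharpolyAt v
              ((arithFrobPolyOfSatake ι v.residueCard 1 α).map (ι : PadicAlgCl ℓ →+* ℂ))) := by
  obtain ⟨ρ, hρ, -, -⟩ := FramedGaloisRep.exists_map_of_isOpen_ker σ
    (FramedArtinRep.isOpen_ker_toMonoidHom σ) (ι.symm : ℂ →+* PadicAlgCl ℓ)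
  have hσ : ∀ g, σ g = Matrix.GeneralLinearGroup.map (ι : PadicAlgCl ℓ →+* ℂ) (ρ g) := by
    intro g
    rw [hρ g]
    ext i j
    simp [Matrix.GeneralLinearGroup.map_apply]
  have hfin : (Set.range ρ).Finite := by
    refine ((finite_range_artinRep σ).image
      (Matrix.GeneralLinearGroup.map (ι.symm : ℂ →+* PadicAlgCl ℓ))).subset ?_
    rintro _ ⟨g, rfl⟩
    exact ⟨σ g, ⟨g, rfl⟩, (hρ g).symm⟩
  refine ⟨ρ, hρ, hσ, isGeometricFramed_of_finite_range 𝓡 ρ hfin, fun hB hirr ↦ ?_⟩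
  obtain ⟨π, hπ, hcorr⟩ := exists_cuspidal_of_finite_range hB ι ρ hfin hirr
  refine ⟨π, hπ, hcorr, hcorr.1.mono fun v ⟨α, hα, hur, hfrob⟩ ↦ ⟨α, hα, ?_, ?_⟩⟩
  · exact FramedGaloisRep.isUnramifiedAt_of_map hσ hur
  · exact FramedGaloisRep.hasFrobCharpolyAt_map hσ hfrob

end SoloBlind

end Summit.Langlands.Langlands.Theorems

end
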